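/-
Origin: expansion seat `planner-pub-hodgecm-pv04-0`, handover 2026-08-18T03:51:01Z (`HOME/pub-hodgecm-pv04/lean/Pv04/PerL34/WAlb.lean`, md5 2f5cf04f, 199 lines);
landed by the gen-5 packager in gate run 20 as `HodgeCM/PerL34/WAlb.lean` (verbatim).
-/
/-
Copyright: pub-hodgecm speedrun, DAG-NODE PROVER #04 (unit pub-hodgecm-pv04).  Node N32 of HOME/LEMMAS.md.
Imports: certified package modules only (`HodgeCM.Geometry.Statements`, `HodgeCM.Automorphic.ThetaFacts`).
Proposed place: `HodgeCM/PerL34/WAlb.lean`; namespace `HodgeCM.PerL34.WAlb`.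
-/
import Summits.HodgeConjecture.HodgeCM.Geometry.Statements
import Summits.HodgeConjecture.HodgeCM.Automorphic.ThetaFacts

/-!
# PerL v5 Lemma 4.2(c) — the existence statement `W^L_Alb` (DAG node N32)

VERBATIM (PerL v5 = blob d912a121, tex ll. 533–534, statement; l. 635, proof):

> (c) Consequently `U_{t^i}(S(K_f)) ≠ 0` for every `(V_3,h)`, every `i` and all sufficiently small `K_f` (this is
> the existence statement `W^L_{Alb}` recorded in the wall).
> …  (c) By (b), Lemma 3.3(a) and Proposition 2.3.

`W^L_Alb` is NOT typed in the certified package (`HodgeCM.Universe.ThetaRealisation.supply` is the theta-side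
statement for the two types `Ψ₀, Ψ₁` only; HOME/LEMMAS.md row N32, DIVERGENCE E3).  This file

1. TYPES it, in the format of `HodgeCM.Universe.PeriodNV` / `PerL` / `PerL44` (`HodgeCM.Geometry.Statements`):
   `AlbNV ι₁ V K Ψ σ` = "for every `i` there are a torsion-free congruence level `Γ`, a morphism
   `F : P_Γ → B_i = A_{(K,Ψ i)}` and a `σ`-eigen holomorphic one-form `α` on `B_i` with `F^*α ≠ 0`", i.e.
   `U_{Ψ_i}(P_Γ) ≠ 0` (`uiso_nonzero_iff`: the span `U.Uiso Γ K Ψ σ` has a nonzero element iff one of its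
   generators `F^*α` is nonzero); `WLAlb44` / `WLAlb` carry the quantifier prefix of `PerL44` / `PerL`
   ("for every `(V₃,h)`" resp. "for some").
2. KERNEL-PROVES the tex's inference "(c) ⇐ (b) + Lemma 3.3(a) + Prop 2.3" at the level of the theta model
   (`uiso_nonzero_of_theta`): a nonzero theta one-form of type `Ψ_i` at some level [(b), with Prop 4.3 / node N31
   for "form ≠ 0"; in the package: `Open_thetaWedge` ⊢ `ThetaRealisation.supply` for `i = 0, 1`] that lies in
   `U_{Ψ_i}` [Lemma 3.3(a) + Prop 2.3 = the instance of `ThetaModel.Open_thetaSub`, node N12a/N05] gives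
   `U_{Ψ_i}(P_Γ) ≠ 0`.  Both inputs are HYPOTHESES (INTERNAL nodes), nothing is asserted.
3. KERNEL-PROVES the wall corollary `W^L_per ⇒ W^L_Alb` (`albNV_of_periodNV`, `wLAlb44_of_perL44`,
   `wLAlb_of_perL`): a nonzero quadrilinear period `∫ F₁^*α₁ ∧ F₂^*α₂ ∧ \overline{F₃^*α₃ ∧ F₄^*α₄} ≠ 0` has four
   nonzero factors, by (semi)linearity of the period in each slot (`Universe.period4_smul₀…₃`).  So once the
   package's `perL` is fed, all four `U_{t^i}` are nonzero at a common level — for EVERY `i`, which route 2 only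
   gives for the types the theta supply covers.

"All sufficiently small `K_f`": the typed statements say "at some level `Γ`"; non-vanishing at every smaller level
follows from the injectivity of pull-back along the finite covering `P_{Γ'} → P_Γ` on `H¹(−, ℂ)` (transfer), a
print fact about the intended model that the `Universe` signature does not posit — recorded, not used.

No new constants; every hypothesis is explicit.
-/

noncomputable section

namespace HodgeCM.PerL34.WAlb

open Literature.AlgebraicGeometry.Motives (CMType HodgeStructure)
open Literature.AlgebraicGeometry.Motives.HodgeStructure (conj)
open HodgeCM HodgeCM.Universe

variable (U : Universe)

/-! ## 1. The typed statement `W^L_Alb` -/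

/-- `U_{Ψ_i}(P_Γ) ≠ 0` for every `i`, at some torsion-free congruence level each: there are `Γ`, a morphism
`F : P_Γ → A_{(K, Ψ i)}` and a `σ`-eigen one-form `α` with `F^*α ≠ 0` (format of `Universe.PeriodNV`). -/
def AlbNV {L : CMField} (ι₁ : L →+* ℂ) (V : HermSpace3 L ι₁) (K : CMField) (Ψ : Fin 4 → CMType K)
    (σ : K →+* ℂ) : Prop :=
  ∀ i : Fin 4, ∃ (Γ : Level V) (F : U.Mor (U.pms L ι₁ V Γ) (U.cmAV K (Ψ i))) (α : U.CohC (U.cmAV K (Ψ i)) 1),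
    α ∈ U.alphaLine K (Ψ i) σ ∧ U.pullC F 1 α ≠ 0

/-- **`W^L_Alb`, "every `(V₃,h)`" form** (PerL Lemma 4.2(c) as stated, tex ll. 533–534), with the quantifier
prefix of `Universe.PerL44`. -/
def WLAlb44 : Prop :=
  ∀ (K L : CMField) (j : K →+* L), IsNormalClosure ℚ K L →
    Module.finrank ℚ K = 6 → (Module.finrank ℚ L = 24 ∨ Module.finrank ℚ L = 48) →
    ∀ (φ : Fin 3 → (K →+* ℂ)), IsFrame φ →
    ∀ (ι₁ : L →+* ℂ), ι₁.comp j = φ 0 →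
    ∀ (t : Fin 4 → CMType K), IsPerLTypes φ t →
      ∀ V : HermSpace3 L ι₁, AlbNV U ι₁ V K t (φ 0)

/-- **`W^L_Alb`, wall form** ("for some `(V₃,h)`"), with the quantifier prefix of `Universe.PerL`. -/
def WLAlb : Prop :=
  ∀ (K L : CMField) (j : K →+* L), IsNormalClosure ℚ K L →
    Module.finrank ℚ K = 6 → (Module.finrank ℚ L = 24 ∨ Module.finrank ℚ L = 48) →
    ∀ (φ : Fin 3 → (K →+* ℂ)), IsFrame φ →
    ∀ (ι₁ : L →+* ℂ), ι₁.comp j = φ 0 →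
    ∀ (t : Fin 4 → CMType K), IsPerLTypes φ t →
      ∃ V : HermSpace3 L ι₁, AlbNV U ι₁ V K t (φ 0)

/-- `U_Ψ(P_Γ)` (the span `Universe.Uiso`) has a nonzero element iff one of its generators `F^*α` is nonzero. -/
theorem uiso_nonzero_iff {L : CMField} {ι₁ : L →+* ℂ} {V : HermSpace3 L ι₁} (Γ : Level V)
    (K : CMField) (Ψ : CMType K) (σ : K →+* ℂ) :
    (∃ ω ∈ U.Uiso Γ K Ψ σ, ω ≠ 0) ↔
      ∃ (F : U.Mor (U.pms L ι₁ V Γ) (U.cmAV K Ψ)) (α : U.CohC (U.cmAV K Ψ) 1),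
        α ∈ U.alphaLine K Ψ σ ∧ U.pullC F 1 α ≠ 0 := by
  constructor
  · rintro ⟨ω, hω, hne⟩
    by_contra hall
    push Not at hall
    apply hne
    have hle : U.Uiso Γ K Ψ σ ≤ ⊥ := by
      refine Submodule.span_le.mpr ?_
      rintro ω' ⟨F, α, hα, rfl⟩
      exact (Submodule.mem_bot ℂ).mpr (hall F α hα)
    exact (Submodule.mem_bot ℂ).mp (hle hω)
  · rintro ⟨F, α, hα, hne⟩
    exact ⟨U.pullC F 1 α, Submodule.subset_span ⟨F, α, hα, rfl⟩, hne⟩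

/-! ## 2. The tex's inference: (c) ⇐ (b) + Lemma 3.3(a) + Prop 2.3, at the level of the theta model -/

/-- **Lemma 4.2(c), proof l. 635, kernel-checked over the theta model.**  In a good seesaw context, a nonzero
theta one-form of type `Ψ_i` at some level (hypothesis `hsupply` = Lemma 4.2(b) with Prop 4.3, nodes N31/N33)
together with the typing `Θ_i(Γ) ⊆ U_{Ψ_i}(Γ)` (hypothesis `hsub` = Lemma 3.3(a) + Prop 2.3, i.e. the instance of
`ThetaModel.Open_thetaSub`, nodes N12a/N05) gives `U_{Ψ_i}(P_Γ) ≠ 0`. -/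
theorem uiso_nonzero_of_theta (T : U.ThetaModel) (hsub : T.Open_thetaSub)
    {L : CMField} {ι₁ : L →+* ℂ} (V : HermSpace3 L ι₁) (c : SeesawCtx L) (hc : T.GoodCtx ι₁ c)
    (i : Fin 4) (hsupply : ∃ Γ : Level V, ∃ ω ∈ T.Theta V c i Γ, ω ≠ 0) :
    ∃ Γ : Level V, ∃ ω ∈ U.Uiso Γ c.K (c.Ψ i) c.σ, ω ≠ 0 := by
  obtain ⟨Γ, ω, hω, hne⟩ := hsupply
  exact ⟨Γ, ω, hsub V c hc i Γ hω, hne⟩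

/-- The same with the conclusion in the generator form of `AlbNV` (one type `i`). -/
theorem albNV_at_of_theta (T : U.ThetaModel) (hsub : T.Open_thetaSub)
    {L : CMField} {ι₁ : L →+* ℂ} (V : HermSpace3 L ι₁) (c : SeesawCtx L) (hc : T.GoodCtx ι₁ c)
    (i : Fin 4) (hsupply : ∃ Γ : Level V, ∃ ω ∈ T.Theta V c i Γ, ω ≠ 0) :
    ∃ (Γ : Level V) (F : U.Mor (U.pms L ι₁ V Γ) (U.cmAV c.K (c.Ψ i))) (α : U.CohC (U.cmAV c.K (c.Ψ i)) 1),
      α ∈ U.alphaLine c.K (c.Ψ i) c.σ ∧ U.pullC F 1 α ≠ 0 := by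
  obtain ⟨Γ, h⟩ := uiso_nonzero_of_theta U T hsub V c hc i hsupply
  obtain ⟨F, α, hα, hne⟩ := (uiso_nonzero_iff U Γ c.K (c.Ψ i) c.σ).mp h
  exact ⟨Γ, F, α, hα, hne⟩

/-- For the two types `Ψ₀, Ψ₁` the supply hypothesis is itself a consequence of the model's input
`Open_thetaWedge` (Prop 4.3: a wedge of theta forms is nonzero, hence so are its factors). -/
theorem theta_supply01 (T : U.ThetaModel) (hwedge : T.Open_thetaWedge)
    {L : CMField} {ι₁ : L →+* ℂ} (V : HermSpace3 L ι₁) (c : SeesawCtx L) (hc : T.GoodCtx ι₁ c) :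
    (∃ Γ : Level V, ∃ ω ∈ T.Theta V c 0 Γ, ω ≠ 0) ∧ (∃ Γ : Level V, ∃ ω ∈ T.Theta V c 1 Γ, ω ≠ 0) := by
  obtain ⟨Γ, ω₁, h₁, ω₂, h₂, hne⟩ := hwedge V c hc
  refine ⟨⟨Γ, ω₁, h₁, ?_⟩, ⟨Γ, ω₂, h₂, ?_⟩⟩
  · rintro rfl
    exact hne (by rw [map_zero, LinearMap.zero_apply])
  · rintro rfl
    exact hne (by rw [map_zero])

/-! ## 3. The wall corollary `W^L_per ⇒ W^L_Alb` -/

section slots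

variable {U}
variable (X : U.Var) (a b c d : U.CohC X 1)

/-- (Ported verbatim from the HodgeCMPerL package; no docstring in the source.) -/
theorem period4_zero₀ : U.period4 X 0 b c d = 0 := by
  have h := period4_smul₀ (U := U) X 0 b c d 0
  simpa only [zero_smul, zero_mul] using h

/-- (Ported verbatim from the HodgeCMPerL package; no docstring in the source.) -/
theorem period4_zero₁ : U.period4 X a 0 c d = 0 := by
  have h := period4_smul₁ (U := U) X a 0 c d 0
  simpa only [zero_smul, zero_mul] using h

/-- (Ported verbatim from the HodgeCMPerL package; no docstring in the source.) -/
theorem period4_zero₂ : U.period4 X a b 0 d = 0 := by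
  have h := period4_smul₂ (U := U) X a b 0 d 0
  simpa only [zero_smul, map_zero, zero_mul] using h

/-- (Ported verbatim from the HodgeCMPerL package; no docstring in the source.) -/
theorem period4_zero₃ : U.period4 X a b c 0 = 0 := by
  have h := period4_smul₃ (U := U) X a b c 0 0
  simpa only [zero_smul, map_zero, zero_mul] using h

/-- A nonzero quadrilinear period has four nonzero arguments. -/
theorem ne_zero_of_period_ne_zero (ω : Fin 4 → U.CohC X 1) (h : U.period X ω ≠ 0) (i : Fin 4) :
    ω i ≠ 0 := by
  intro h0
  apply h
  rw [period_eq_period4]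
  fin_cases i
  · simp only [Fin.zero_eta, Fin.isValue] at h0
    rw [h0]; exact period4_zero₀ X (ω 1) (ω 2) (ω 3)
  · simp only [Fin.mk_one, Fin.isValue] at h0
    rw [h0]; exact period4_zero₁ X (ω 0) (ω 2) (ω 3)
  · simp only [Fin.reduceFinMk, Fin.isValue] at h0
    rw [h0]; exact period4_zero₂ X (ω 0) (ω 1) (ω 3)
  · simp only [Fin.reduceFinMk, Fin.isValue] at h0
    rw [h0]; exact period4_zero₃ X (ω 0) (ω 1) (ω 2)

end slots

/-- **`W^L_per`-conclusion ⇒ `W^L_Alb`-conclusion** for one datum `(ι₁, V, K, Ψ, σ)`: the four factors of a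
nonzero period are nonzero elements of the four isotypic parts, at a common level. -/
theorem albNV_of_periodNV {L : CMField} (ι₁ : L →+* ℂ) (V : HermSpace3 L ι₁) (K : CMField)
    (Ψ : Fin 4 → CMType K) (σ : K →+* ℂ) (h : U.PeriodNV ι₁ V K Ψ σ) : AlbNV U ι₁ V K Ψ σ := by
  obtain ⟨Γ, F, α, hα, hper⟩ := h
  intro i
  exact ⟨Γ, F i, α i, hα i, ne_zero_of_period_ne_zero (U.pms L ι₁ V Γ) _ hper i⟩

/-- **PerL Thm 4.4 (as proved: every `(V₃,h)`) ⇒ Lemma 4.2(c) `W^L_Alb` (every `(V₃,h)`).** -/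
theorem wLAlb44_of_perL44 (h : U.PerL44) : WLAlb44 U := by
  intro K L j hN hK hL φ hφ ι₁ hι t ht V
  exact albNV_of_periodNV U ι₁ V K t (φ 0) (h K L j hN hK hL φ hφ ι₁ hι t ht V)

/-- **`W^L_per` ⇒ `W^L_Alb`** (wall forms, "for some `(V₃,h)`"). -/
theorem wLAlb_of_perL (h : U.PerL) : WLAlb U := by
  intro K L j hN hK hL φ hφ ι₁ hι t ht
  obtain ⟨V, hV⟩ := h K L j hN hK hL φ hφ ι₁ hι t ht
  exact ⟨V, albNV_of_periodNV U ι₁ V K t (φ 0) hV⟩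

end HodgeCM.PerL34.WAlb

end
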